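import Literature.NumberTheory.EllipticCurves.ComplexMultiplicationShaThreeLeavesProofs
import Literature.NumberTheory.EllipticCurves.ComplexMultiplicationHasCMHeegnerStarkProofs
import Literature.NumberTheory.QuadraticFields.ClassNumberOneLandauProofs
import HarnessLib

/-!
# bsd.S28 (Rubin): finiteness of `Ш(E/ℚ)` for CM curves with `L(E,1) ≠ 0` — the census after
the discharge of the class number one theorem: one leaf, Rubin's Theorem A

Sibling *proofs* file (D-0014 append protocol: a new file, every declaration a theorem, no
definition, no named fact introduced or restated) of
`Literature.NumberTheory.EllipticCurves.ComplexMultiplication` for the named fact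
`Literature.NumberTheory.EllipticCurves.shaFinite_of_hasCM_of_L_one_ne_zero` (**bsd.S28**, `Ш`
part: *for an elliptic curve `E/ℚ` with complex multiplication and `L(E/ℚ, 1) ≠ 0`, `Ш(E/ℚ)` is
finite* — K. Rubin, Invent. Math. 89 (1987), §0 Remark (3), p. 528, from the paper's Theorem A,
p. 527, applied to `E_K` over the CM field `K`).

`ComplexMultiplicationShaThreeLeavesProofs.lean` derived the fact, sorry-free, from exactly three
named facts of the tree: the two halves of Rubin's Theorem A (a) for `E_K` —
`Rubin1987_sha_torsionBy_eq_bot_cofinite` (Thm. 6.6) and `Rubin1987_sha_primary_finite` (§10) —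
and the class number one theorem for imaginary quadratic orders,
`Literature.NumberTheory.QuadraticFields.BinaryQuadraticForm.mem_classNumberOneDiscrs_of_classNumber_eq_one`
(Cox, *Primes of the form x² + ny²*, Thm. 7.30(ii); Heegner 1952 – Baker 1966 – Stark 1967).
The third leaf has since been **discharged** in the tree:
`mem_classNumberOneDiscrs_of_classNumber_eq_one_holds`
(`QuadraticFields/ClassNumberOneLandauProofs.lean`, by Baker's route, *Transcendental Number
Theory* Ch. 5 §4: limit formula, fundamental inequality, explicit two-logarithm bound for
`p > 10⁸⁰`, kernel-checked certificates below), and with it both halves of the classification of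
the rational CM `j`-invariants: `j_mem_cmJInvariants_of_hasCM_holds` and
`WeierstrassCurve.hasCM_iff_j_mem_holds` (`ComplexMultiplicationHasCMIffHoldsProofs.lean`;
Silverman, *AEC*, App. C §11, Examples 11.3.1–11.3.2).

This file records the resulting census, machine-checked — theorems only:

* `shaFinite_of_hasCM_of_L_one_ne_zero_iff_maximalOrder` (**proved, unconditional**): the fact is
  *equivalent* to its maximal-order case `shaFinite_of_j_mem_maximalCMJInvariants_of_L_one_ne_zero`
  (`j(E)` one of the nine invariants of curves with CM by `𝓞_K`; the case Remark (3) literally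
  addresses): `⟸` by the rational cyclic isogeny onto a maximal-order curve and the isogeny
  invariance of `L(E, s)` and of the finiteness of `Ш` (level 6,
  `shaFinite_of_hasCM_of_L_one_ne_zero_of_maximalOrder_of_j_mem_cmJInvariants_of_hasCM`, its
  classification hypothesis now `j_mem_cmJInvariants_of_hasCM_holds`); `⟹` because the nine
  invariants are CM invariants (`hasCM_of_j_mem_maximalCMJInvariants_holds`).
* `shaFinite_of_hasCM_of_L_one_ne_zero_of_one_leaf` (**proved**): the fact follows from **one**
  named fact of the tree, `Rubin1987_shaFinite_baseChange_cmField` — Rubin's Theorem A (a) for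
  the base change `E_K` of a maximal-order CM curve `E/ℚ` to its CM field (*"If `L(E/K, 1) ≠ 0`
  then `Ш` is finite"*, p. 527) — and nothing else: Deuring's `L(E_K/K, s) = L(E/ℚ, s)²`
  (`Deuring_LFunction_baseChange_cmField_holds`), the finiteness of
  `ker (Ш(E/ℚ) → Ш(E_K/K))` (`shaFinite_of_baseChange`) and the classification being theorems.
  This is the implication *"Theorem A implies the analogous statement over `ℚ`"* of Remark (3),
  p. 528, now for **every** CM curve over `ℚ` (the maximal-order case
  `shaFinite_of_j_mem_maximalCMJInvariants_of_L_one_ne_zero_of_thmA` of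
  `ComplexMultiplicationShaThreeLeavesProofs.lean` transported along the equivalence above).
* `shaFinite_of_hasCM_of_L_one_ne_zero_of_two_leaves` (**proved**): the same from the paper's two
  halves of Theorem A (a) for `E_K` (`h66`: Thm. 6.6, `Ш(E_K/K)[p] = 0` for almost all `p`;
  `h10`: §10, `Ш(E_K/K)[p^∞]` finite for every `p`), through
  `Rubin1987_shaFinite_baseChange_cmField_of_level2` (`Ш` is torsion; proved in `ShaTorsion`).

Hence the discharge `shaFinite_of_hasCM_of_L_one_ne_zero_holds` is now the one-liner
`shaFinite_of_hasCM_of_L_one_ne_zero_of_one_leaf Rubin1987_shaFinite_baseChange_cmField_holds`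
(or `…_of_two_leaves h66 h10`) once Theorem A (a) for `E_K` — elliptic units, Wiles' explicit
reciprocity law and the Euler-system descent of §§1–10 of Rubin's paper, absent from Mathlib
v4.32.0 — is a theorem of the tree; the alternative trust base
`shaFinite_of_hasCM_of_L_one_ne_zero_of_grossZagierKolyvagin` (Gross–Zagier–Kolyvagin with
modularity) is unchanged. Nothing in the statement of the target, or of any leaf, is changed here.

## References

* K. Rubin, *Tate–Shafarevich groups and L-functions of elliptic curves with complex
  multiplication*, Invent. Math. 89 (1987), 527–560: Thm. A (p. 527), §0 Remark (3) (p. 528),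
  Thm. 6.6 (p. 541), §10 (pp. 548–549); review Zbl 0628.14018. [Rubin1987Sha]
* J. H. Silverman, *The Arithmetic of Elliptic Curves*, 2nd ed., GTM 106 (2009), App. C §11,
  Examples 11.3.1–11.3.2. [SilvermanAEC2009]
* J. H. Silverman, *Advanced Topics in the Arithmetic of Elliptic Curves*, GTM 151 (1994), Ch. II
  Thm. 10.5 (Deuring). [SilvermanATAEC1994]
* D. A. Cox, *Primes of the form x² + ny²*, 2nd ed. (2013), Thm. 7.30(ii). [Cox2013]
-/

noncomputable section

namespace Literature.NumberTheory.EllipticCurves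

open Literature.NumberTheory.QuadraticFields.BinaryQuadraticForm
  (HeegnerStarkPrimeThreeModEight_holds mem_classNumberOneDiscrs_of_classNumber_eq_one_holds)

/-- **bsd.S28 (`Ш` part) is equivalent to its maximal-order case — unconditionally.**
`shaFinite_of_hasCM_of_L_one_ne_zero` (`E/ℚ` with CM and `L(E/ℚ, 1) ≠ 0 ⇒ Ш(E/ℚ)` finite) holds
iff it holds for the curves with `j(E) ∈ maximalCMJInvariants` (CM by a maximal order `𝓞_K`,
`shaFinite_of_j_mem_maximalCMJInvariants_of_L_one_ne_zero`). `⟹`: the nine maximal-order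
invariants are CM invariants (`hasCM_of_j_mem_maximalCMJInvariants_holds`, Silverman *AEC*
C.11.3.1). `⟸`: a CM curve over `ℚ` has `j(E)` among the thirteen class-number-one invariants
(`j_mem_cmJInvariants_of_hasCM_of_heegnerStarkPrime HeegnerStarkPrimeThreeModEight_holds`, the
term the tree names `j_mem_cmJInvariants_of_hasCM_holds` in
`ComplexMultiplicationHasCMIffHoldsProofs.lean`: a theorem by the class number one theorem,
`HeegnerStarkPrimeThreeModEight_holds` / `mem_classNumberOneDiscrs_of_classNumber_eq_one_holds` of
`QuadraticFields/ClassNumberOneLandauProofs.lean`) and is then `ℚ`-isogenous, by a rational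
cyclic isogeny, to a maximal-order curve with the same `L`-function and equi-finite `Ш` (level 6,
`shaFinite_of_hasCM_of_L_one_ne_zero_of_maximalOrder_of_j_mem_cmJInvariants_of_hasCM`: Knapp
Thm. 11.67 and Milne *ADT* I.7.1(b), both proved in the tree). This is the reduction Rubin's
Remark (3) leaves to the reader ("an elliptic curve over `ℚ` with complex multiplication").
[cite: Rubin1987Sha, §0 Remark (3) (p. 528)]
[cite: SilvermanAEC2009, App. C §11 Example 11.3.1–11.3.2] -/
theorem shaFinite_of_hasCM_of_L_one_ne_zero_iff_maximalOrder :
    shaFinite_of_hasCM_of_L_one_ne_zero ↔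
      shaFinite_of_j_mem_maximalCMJInvariants_of_L_one_ne_zero := by
  refine ⟨fun h W _ hj hL => h W (hasCM_of_j_mem_maximalCMJInvariants_holds W hj) hL, fun h9 => ?_⟩
  exact shaFinite_of_hasCM_of_L_one_ne_zero_of_maximalOrder_of_j_mem_cmJInvariants_of_hasCM h9
    (j_mem_cmJInvariants_of_hasCM_of_heegnerStarkPrime HeegnerStarkPrimeThreeModEight_holds)

/-- **bsd.S28 (`Ш` part) — census: one leaf, Rubin's Theorem A (a) for `E_K`.**
`shaFinite_of_hasCM_of_L_one_ne_zero` (`E/ℚ` with CM and `L(E/ℚ, 1) ≠ 0 ⇒ Ш(E/ℚ)` finite; Rubin,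
Invent. Math. 89 (1987), §0 Remark (3), p. 528) follows, sorry-free, from exactly **one** named
fact of the tree: `Rubin1987_shaFinite_baseChange_cmField`, Theorem A (a) of the paper (p. 527:
*"If `L(E/K, 1) ≠ 0` then `Ш` is finite"*) for the base change `E_K` of a maximal-order CM curve
`E/ℚ` to its CM field `K`. The rest of Remark (3) is proved in the tree: the maximal-order case
from Theorem A alone (`shaFinite_of_j_mem_maximalCMJInvariants_of_L_one_ne_zero_of_thmA`:
`L(E_K/K, 1) = L(E/ℚ, 1)² ≠ 0` by Deuring, `Deuring_LFunction_baseChange_cmField_holds` with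
`entireLFunction_one_ne_zero_of_LFunction_eq_mul_self`; `ker (Ш(E/ℚ) → Ш(E_K/K))` finite,
`shaFinite_of_baseChange`), and the passage from an arbitrary CM curve over `ℚ` to a
maximal-order one (`shaFinite_of_hasCM_of_L_one_ne_zero_iff_maximalOrder`, the classification
`j_mem_cmJInvariants_of_hasCM_holds` resting on the class number one theorem
`mem_classNumberOneDiscrs_of_classNumber_eq_one_holds`).
[cite: Rubin1987Sha, Thm. A (p. 527) and §0 Remark (3) (p. 528)] -/
theorem shaFinite_of_hasCM_of_L_one_ne_zero_of_one_leaf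
    (hA : Rubin1987_shaFinite_baseChange_cmField) :
    shaFinite_of_hasCM_of_L_one_ne_zero :=
  shaFinite_of_hasCM_of_L_one_ne_zero_iff_maximalOrder.2
    (shaFinite_of_j_mem_maximalCMJInvariants_of_L_one_ne_zero_of_thmA hA)

/-- **bsd.S28 (`Ш` part) — census: the paper's two halves of Theorem A (a).**
`shaFinite_of_hasCM_of_L_one_ne_zero` follows, sorry-free, from Rubin's Thm. 6.6 for `E_K`
(`h66`: `L(E_K/K, 1) ≠ 0 ⇒ Ш(E_K/K)[p] = 0` for all but finitely many rational primes `p`) and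
the `𝔭`-primary finiteness of §10 for `E_K` (`h10`: `L(E_K/K, 1) ≠ 0 ⇒ Ш(E_K/K)[p^∞]` finite
for every `p`) — together Theorem A (a) for `E_K`, `Ш(E_K/K)` being a torsion group
(`Rubin1987_shaFinite_baseChange_cmField_of_level2`, with `WeierstrassCurve.isTorsion_sha` and
`WeierstrassCurve.shaFinite_of_primary` proved in `ShaTorsion`) — and nothing else: the
three-leaves census `shaFinite_of_hasCM_of_L_one_ne_zero_of_three_leaves h66 h10 hh` of
`ComplexMultiplicationShaThreeLeavesProofs.lean` with its class-number-one leaf `hh` fed by the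
theorem `mem_classNumberOneDiscrs_of_classNumber_eq_one_holds`. (By proof irrelevance this is also
`shaFinite_of_hasCM_of_L_one_ne_zero_of_one_leaf (Rubin1987_shaFinite_baseChange_cmField_of_level2 h66 h10)`.)
[cite: Rubin1987Sha, Thm. A (p. 527), §0 Remark (3) (p. 528), Thm. 6.6 (p. 541) and §10 (pp. 548–549)]
[cite: Cox2013, §7.D Thm. 7.30(ii)] -/
theorem shaFinite_of_hasCM_of_L_one_ne_zero_of_two_leaves
    (h66 : Rubin1987_sha_torsionBy_eq_bot_cofinite) (h10 : Rubin1987_sha_primary_finite) :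
    shaFinite_of_hasCM_of_L_one_ne_zero :=
  shaFinite_of_hasCM_of_L_one_ne_zero_of_three_leaves h66 h10
    mem_classNumberOneDiscrs_of_classNumber_eq_one_holds

end Literature.NumberTheory.EllipticCurves

end
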